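import Literature.InformationTheory.QuantumCodes.QuantumExpanderNoisySyndromeTheorem13
import Literature.InformationTheory.QuantumCodes.SyndromeAdjacencyGraph
import HarnessLib

/-!
# Small-set-flip with a NOISY syndrome (Fawzi–Grospellier–Leverrier, FOCS 2018), part 11: Theorem 13 on the concrete syndrome adjacency
# graph of `Q_G` — all three clauses, no free graph parameter — PROOF

Index of sources: `[cite: FawziGrospellierLeverrier2018FT]` = Fawzi–Grospellier–Leverrier, FOCS 2018 / arXiv:1808.03821, Thm. 13 (p0016 L66-73) and its
proof (p0021 L23 – p0022 L20), §3.4 (`𝒢`, p0019 L3-4), Lemma 27; `[cite: FawziGrospellierLeverrier2018]` Thm. 17; `[cite: Gottesman2014]` Lemma 2.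

Topic `Literature/InformationTheory/QuantumCodes` (venture QEC, row 04 `prover-qec-type-04` gen 8, line L-SSF-NOISY = PARTITION v2.48 D50.L8, node N21).
Parts 9–10 proved Thm. 13 (our constants) for an arbitrary syndrome adjacency graph `G'` and arbitrary degree bounds; this file plugs in the tree's
concrete graph `syndromeAdjGraph (expanderHX H) (expanderHZ H)` (part N17) with its degree bound `d' = 2·max Δ·(Δ_A + Δ_B − 1) + (Δ_A + Δ_B)` and the
qubit-graph bound `Δ_Q = 2·max Δ·(Δ_A + Δ_B − 1)` (`degree_checkGraph_fromRows_le_max`), giving ONE statement with the three clauses of Thm. 13: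
(i) the event succᶜ `= HasAlphaCluster 𝒢 α₀ (t+1)` has `μ`-weight `≤ |V ⊔ C_X|·r^{t+1}/(d'²(1 − r))`, `r = 2d'²p^{α₀}` (Lemma 27, Peierls constant);
(ii) on succ, `E_ls ≡ E ⊕ Ê`; (iii) on succ, `E_ls` is locally stochastic with parameter `√y·(1 + Σ_{k ≤ n} Δ_Q^{2(k−1)}(√y)^k)`, `y = 2^{max Δ}p^{1/c₀}`.

* ★ `fgl18b_theorem13_expander` — the statement above.

HONEST FRAMING as in part 10 (our constants: exponent `1/(2c₀)`, Peierls counts, one-parameter joint law `p = max(p_phys, p_synd)`). PROVED (kernel);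
no definitions, no named facts.
-/

namespace Literature.InformationTheory.QuantumCodes

open Finset Matrix Literature.Probability.LatticeModels

namespace QuantumExpander

variable {A B : Type*} [Fintype A] [Fintype B] [DecidableEq A] [DecidableEq B]

open scoped Classical in
/-- ★ **FGL18b Theorem 13 for the quantum expander code `Q_G`, concrete form (our constants).** Let `G` be `(Δ_A, Δ_B)`-biregular (`Δ ≥ 1`) and
`(γ_A, δ_A, γ_B, δ_B)`-expanding with `0 ≤ δ_A, δ_B`, `β₁ = 1 − 16·max(δ_A,δ_B)`; `Dec` ANY small-set-flip decoder of the tree (`0 < κ`, `2κ < min Δ·β₁`);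
`μ` a locally stochastic law of parameter `p ∈ [0,1]` for the joint error `X = E ⊔ D ⊆ V ⊔ C_X` of one round (qubit faults `E`, syndrome-bit faults `D`);
`𝒢 = syndromeAdjGraph H_X H_Z` the syndrome adjacency graph, `d' = 2·max Δ·(Δ_A+Δ_B−1) + (Δ_A+Δ_B)`, `Δ_Q = 2·max Δ·(Δ_A+Δ_B−1)`, `α₀ = κ/(2(κ + max Δ))`,
`c₀ = 4/(min Δ·β₁ − 2κ)`, `y = 2^{max Δ}·p^{1/c₀} ≤ 1`, `r = 2d'²p^{α₀} < 1`, and `t` with `max Δ·t ≤ min Δ·min(γ_A n_A, γ_B n_B)`. Then there is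
`E_ls : X ↦ 𝔽₂^V` with: (i) `Σ_{X : HasAlphaCluster 𝒢 α₀ (t+1) X} μ X ≤ |V ⊔ C_X|·r^{t+1}/(d'²(1−r))`; (ii) for `X` outside that event,
`E_ls(X) ≡ E ⊕ Dec(σ_X(E) ⊕ 𝟙_D)` modulo `C_Z^⊥`; (iii) for every `S ⊆ V`,
`Σ_{X outside, S ⊆ supp E_ls(X)} μ X ≤ (√y·(1 + Σ_{k=1}^{|V|} Δ_Q^{2(k−1)}(√y)^k))^{|S|}`.
[cite: FawziGrospellierLeverrier2018FT, Thm 13 (arXiv p0016 L66-73) and its proof (p0021 L23 – p0022 L20); §3.4 (𝒢); Lemma 27] [cite: Gottesman2014, Lemma 2] -/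
theorem fgl18b_theorem13_expander (H : Matrix B A (ZMod 2)) {dA dB : ℕ} {γA δA γB δB : ℝ}
    (hreg : IsBiregular H dA dB) (hexp : IsLeftRightExpanding H dA dB γA δA γB δB)
    (hdA : 0 < dA) (hdB : 0 < dB) (hδA : 0 ≤ δA) (hδB : 0 ≤ δB)
    {κ : ℝ} (hκ0 : 0 < κ) (hκ1 : 2 * κ < ((min dA dB : ℕ) : ℝ) * (1 - 16 * max δA δB))
    (Dec : Decoder (A × B → ZMod 2) ((A × A) ⊕ (B × B) → ZMod 2))
    (hDec : IsSSFDecoder κ (expanderHX H) (expanderHZ H) Dec)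
    {μ : Finset (((A × A) ⊕ (B × B)) ⊕ (A × B)) → ℝ} {p : ℝ} (hμ : IsLocallyStochastic μ p) (hp0 : 0 ≤ p) (hp1 : p ≤ 1)
    {t : ℕ} (ht : ((max dA dB : ℕ) : ℝ) * t ≤ ((min dA dB : ℕ) : ℝ) * min (γA * Fintype.card A) (γB * Fintype.card B))
    (hy1 : (2 : ℝ) ^ (max dA dB) * p ^ (1 / (4 / (((min dA dB : ℕ) : ℝ) * (1 - 16 * max δA δB) - 2 * κ))) ≤ 1)
    (hr : 2 * ((2 * max dA dB * (dA + dB - 1) + (dA + dB) : ℕ) : ℝ) ^ 2 * p ^ (κ / (2 * (κ + ((max dA dB : ℕ) : ℝ)))) < 1) :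
    ∃ eLs : Finset (((A × A) ⊕ (B × B)) ⊕ (A × B)) → ((A × A) ⊕ (B × B) → ZMod 2),
      (∑ X ∈ univ.filter (fun X =>
          HasAlphaCluster (SmallSetFlip.syndromeAdjGraph (expanderHX H) (expanderHZ H))
            (κ / (2 * (κ + ((max dA dB : ℕ) : ℝ)))) (t + 1) X), μ X
        ≤ (Fintype.card (((A × A) ⊕ (B × B)) ⊕ (A × B)) : ℝ)
            * (2 * ((2 * max dA dB * (dA + dB - 1) + (dA + dB) : ℕ) : ℝ) ^ 2 * p ^ (κ / (2 * (κ + ((max dA dB : ℕ) : ℝ))))) ^ (t + 1)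
          / (((2 * max dA dB * (dA + dB - 1) + (dA + dB) : ℕ) : ℝ) ^ 2
            * (1 - 2 * ((2 * max dA dB * (dA + dB - 1) + (dA + dB) : ℕ) : ℝ) ^ 2 * p ^ (κ / (2 * (κ + ((max dA dB : ℕ) : ℝ))))))) ∧
      (∀ X, ¬ HasAlphaCluster (SmallSetFlip.syndromeAdjGraph (expanderHX H) (expanderHZ H))
          (κ / (2 * (κ + ((max dA dB : ℕ) : ℝ)))) (t + 1) X →
        eLs X + (flipVec (univ.filter fun q => Sum.inl q ∈ X)
          + Dec (expanderHX H *ᵥ flipVec (univ.filter fun q => Sum.inl q ∈ X)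
              + flipVec (univ.filter fun c => Sum.inr c ∈ X))) ∈ rowSpace (expanderHZ H)) ∧
      ∀ S : Finset ((A × A) ⊕ (B × B)),
        ∑ X ∈ univ.filter (fun X =>
            ¬ HasAlphaCluster (SmallSetFlip.syndromeAdjGraph (expanderHX H) (expanderHZ H))
                (κ / (2 * (κ + ((max dA dB : ℕ) : ℝ)))) (t + 1) X ∧ S ⊆ supp (eLs X)), μ X
          ≤ (Real.sqrt ((2 : ℝ) ^ (max dA dB) * p ^ (1 / (4 / (((min dA dB : ℕ) : ℝ) * (1 - 16 * max δA δB) - 2 * κ))))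
              * (1 + ∑ k ∈ Finset.Icc 1 (Fintype.card ((A × A) ⊕ (B × B))),
                  ((2 * max dA dB * (dA + dB - 1) : ℕ) : ℝ) ^ (2 * (k - 1))
                * (Real.sqrt ((2 : ℝ) ^ (max dA dB) * p ^ (1 / (4 / (((min dA dB : ℕ) : ℝ) * (1 - 16 * max δA δB) - 2 * κ))))) ^ k))
            ^ S.card := by
  classical
  set G' := SmallSetFlip.syndromeAdjGraph (expanderHX H) (expanderHZ H) with hG'
  have hlift : ∀ q q', (checkGraph (Matrix.fromRows (expanderHX H) (expanderHZ H))).Adj q q' → G'.Adj (Sum.inl q) (Sum.inl q') :=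
    fun q q' h => (SmallSetFlip.syndromeAdjGraph_adj_inl_inl _ _ q q').2 h
  have hinc : ∀ c q, expanderHX H c q ≠ 0 → G'.Adj (Sum.inl q) (Sum.inr c) :=
    fun c q h => (SmallSetFlip.syndromeAdjGraph_adj_inl_inr _ _ q c).2 h
  have hΔQ : ∀ q, (checkGraph (Matrix.fromRows (expanderHX H) (expanderHZ H))).degree q ≤ 2 * max dA dB * (dA + dB - 1) :=
    fun q => degree_checkGraph_fromRows_le_max H hreg q
  have hdeg : ∀ x, G'.degree x ≤ 2 * max dA dB * (dA + dB - 1) + (dA + dB) :=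
    fun x => degree_syndromeAdjGraph_le H hreg x
  obtain ⟨eLs, hequiv, hls⟩ := fgl18b_theorem13 H hreg hexp hdA hdB hδA hδB hκ0 hκ1 G' hlift hinc hΔQ Dec hDec hμ hp0 hp1 ht hy1
  refine ⟨eLs, ?_, hequiv, hls⟩
  -- (i) Lemma 27: the tree's α-percolation bound on `𝒢`
  have hα0 : 0 < κ / (2 * (κ + ((max dA dB : ℕ) : ℝ))) := by positivity
  have hd1 : 1 ≤ 2 * max dA dB * (dA + dB - 1) + (dA + dB) := by
    have : 1 ≤ dA + dB := le_trans hdA (Nat.le_add_right _ _)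
    omega
  exact sum_hasAlphaCluster_le_geometric hdeg hd1 hμ hp0 hp1 hα0 (Nat.succ_le_succ (Nat.zero_le t)) hr

end QuantumExpander

end Literature.InformationTheory.QuantumCodes
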